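import Summits.KontsevichZagierPeriods.KontsevichZagierPeriods.Theses.FermatIsogeny
import Summits.KontsevichZagierPeriods.KontsevichZagierPeriods.Theorems.TerasomaMultiplicationGammaHodgeSectorMultiplicationContainment
import Summits.KontsevichZagierPeriods.KontsevichZagierPeriods.Theorems.TerasomaMultiplicationGammaHodgeSectorAfterMultiplication

/-!
# `BetaProductSector` (stmt-KontsevichZagierPeriods-3898, route FermatIsogeny, rank 4) — line `hodge_split` (v2)

Crux: Conjecture 1 of Kontsevich–Zagier on the beta-PRODUCT sector (dimension 2): if
`B(a,b)B(e,d) = q · B(a',b')B(e',d')` with `q` real algebraic (eight positive rationals), the two product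
representations `[(0,1)², x^{a-1}(1-x)^{b-1} y^{e-1}(1-y)^{d-1}]`, `[(0,1)², q · x^{a'-1}(1-x)^{b'-1} y^{e'-1}(1-y)^{d'-1}]`
(equal values) are `KZ.Equivalent`.

Line `hodge_split` (crux-strategist, 2026-08-17; v2 = two stubs after the whole calculus half was reduced
to the sibling crux) = the TYPED DECOMPOSITION of the crux along the Deligne–Koblitz–Ogus Hodge-type
condition of the datum at weight `0`,
`H(u) : ({ua}+{ub}−{u(a+b)}) + ({ue}+{ud}−{u(e+d)}) = ({ua'}+{ub'}−{u(a'+b')}) + ({ue'}+{ud'}−{u(e'+d')})`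
for every `u ≥ 1` coprime to the eight denominators (`{·} = Int.fract`). Stubs:

* `stub_hodgeType` — VALUE ⇒ HODGE TYPE (the transcendence atom, NO KZ content; = proposed split child
  `BetaProductHodgeType`): the `(2,2)` weight-`0` instance of the Lang–Rohrlich conjecture (linear sub-case =
  Wolfart–Wüstholz 1985); conjecture-grade, expected stamp open-problem.
* `stub_hodgeSector` — Conjecture 1 on the HODGE-TYPE beta-product sector (= proposed split child
  `BetaProductHodgeSector`): PROVED BELOW from `GammaHodgeSector` (stmt-3742) for ALL positive rational
  exponents (`stub_hodgeSector_of_gammaHodgeSector`: integral-exponent factors are constants of `P`, the kept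
  admissible factors form a 3742 datum whose Hodge test is lifted along `ZMod.unitsMap_surjective`), hence from
  `SelbergAMGM.PositiveCancellation` (stmt-5621) alone (`stub_hodgeSector_of_positiveCancellation`). As a stub it
  stays sorried (3742 / 5621 open); it closes by `exact stub_hodgeSector_of_gammaHodgeSector h` the day either lands.

So the crux is `stub_hodgeType ∧ (an instance family of 3742)`: its entire Kontsevich–Zagier content lies in
the sibling route's crux, and what is specific to it is pure transcendence. Composition (sorry-free): the value
equality of the pinned pair IS the Beta identity (`betaProduct_identity_of_valueEq`) ⇒ `H` (`stub_hodgeType`) ⇒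
the crux (`stub_hodgeSector`). `BetaProductSector_of : BetaProductSector` feeds the two stubs in BY NAME.
The split glue `BetaProductHodgeType → BetaProductHodgeSector → BetaProductSector` is `Cruxes/BetaProductSector/SplitGlue.lean`;
the reduction is also the Theorems candidate `FermatIsogenyBetaProductHodgeSectorOfGammaHodge.lean` (evidence).
Disproof used: none on file. Dead lines: none. NOT skeleton-registered by the strategist (registration would
expire the lead's active `birth` stubs); register with `ledger skeleton check
$(ledger crux dir stmt-KontsevichZagierPeriods-3898)/Lines/hodge_split.lean --crux stmt-KontsevichZagierPeriods-3898` when switching.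
-/

set_option linter.dupNamespace false

noncomputable section

namespace Summit.KontsevichZagierPeriods.KontsevichZagierPeriods.Cruxes.BetaProductSector.HodgeSplit

open Summit.KontsevichZagierPeriods.KontsevichZagierPeriods.Theses.FermatIsogeny (BetaProductSector)

/-! ## The two stubs -/

/-- Stub 1 — VALUE ⇒ HODGE TYPE (transcendence atom; split child `BetaProductHodgeType` verbatim).
[cite: Deligne1982HodgeCycles, Thm. 7.18] [cite: WolfartWustholz1985] -/
theorem stub_hodgeType : ∀ (a b e d a' b' e' d' : ℚ) (q : ℝ), 0 < a → 0 < b → 0 < e → 0 < d → 0 < a' → 0 < b' → 0 < e' → 0 < d' → IsAlgebraic ℚ q → ProbabilityTheory.beta (a:ℝ) b * ProbabilityTheory.beta (e:ℝ) d = q * (ProbabilityTheory.beta (a':ℝ) b' * ProbabilityTheory.beta (e':ℝ) d') → ∀ u : ℕ, 0 < u → Nat.Coprime u a.den → Nat.Coprime u b.den → Nat.Coprime u e.den → Nat.Coprime u d.den → Nat.Coprime u a'.den → Nat.Coprime u b'.den → Nat.Coprime u e'.den → Nat.Coprime u d'.den → (Int.fract ((u:ℚ) * a) + Int.fract ((u:ℚ)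 * b) - Int.fract ((u:ℚ) * (a + b))) + (Int.fract ((u:ℚ) * e) + Int.fract ((u:ℚ) * d) - Int.fract ((u:ℚ) * (e + d))) = (Int.fract ((u:ℚ) * a') + Int.fract ((u:ℚ) * b') - Int.fract ((u:ℚ) * (a' + b'))) + (Int.fract ((u:ℚ) * e') + Int.fract ((u:ℚ) * d') - Int.fract ((u:ℚ) * (e' + d'))) := by
  sorry

/-- Stub 2 — Conjecture 1 on the Hodge-type beta-product sector (split child `BetaProductHodgeSector`
verbatim); proved below from `GammaHodgeSector` (stmt-3742), sorried here because 3742 is open.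
[cite: KontsevichZagier2001, §1.2 Conjecture 1] [cite: Deligne1982HodgeCycles, Thm. 7.18] -/
theorem stub_hodgeSector : ∀ (a b e d a' b' e' d' : ℚ) (q : ℝ), 0 < a → 0 < b → 0 < e → 0 < d → 0 < a' → 0 < b' → 0 < e' → 0 < d' → IsAlgebraic ℚ q → (∀ u : ℕ, 0 < u → Nat.Coprime u a.den → Nat.Coprime u b.den → Nat.Coprime u e.den → Nat.Coprime u d.den → Nat.Coprime u a'.den → Nat.Coprime u b'.den → Nat.Coprime u e'.den → Nat.Coprime u d'.den → (Int.fract ((u:ℚ) * a) + Int.fract ((u:ℚ) * b) - Int.fract ((u:ℚ) * (a + b))) + (Int.fract ((u:ℚ) * e) + Int.fract ((u:ℚ) * d) - Int.fract ((u:ℚ) * (e + d))) = (Int.fract ((u:ℚ) * a') + Int.fract ((u:ℚ) * b') - Int.fract ((u:ℚ) * (a' + b'))) + (Int.fract ((u:ℚ) * e') + Int.fract ((u:ℚ) * d') - Int.fract ((u:ℚ) * (e' + d')))) → ∀ (r r' : Literature.NumberTheory.Transcendental.KZ.IntegralRep 2), r.domain = {x | ∀ i, x i ∈ Set.Ioo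 (0:ℝ) 1} → Set.EqOn r.integrand (fun x => (x 0) ^ ((a:ℝ) - 1) * (1 - x 0) ^ ((b:ℝ) - 1) * (x 1) ^ ((e:ℝ) - 1) * (1 - x 1) ^ ((d:ℝ) - 1)) r.domain → r'.domain = {x | ∀ i, x i ∈ Set.Ioo (0:ℝ) 1} → Set.EqOn r'.integrand (fun x => q * (x 0) ^ ((a':ℝ) - 1) * (1 - x 0) ^ ((b':ℝ) - 1) * (x 1) ^ ((e':ℝ) - 1) * (1 - x 1) ^ ((d':ℝ) - 1)) r'.domain → r.value = r'.value → Literature.NumberTheory.Transcendental.KZ.Equivalent r r' := by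
  sorry

/-! ## Glue (sorry-free) -/

open MeasureTheory Set
open Literature.NumberTheory.Transcendental
open Literature.NumberTheory.Transcendental.KZ
open Summit.KontsevichZagierPeriods.GammaHodgeSectorNegative
  (Admissible CoprimeDen hodgeSum HodgeCondition IsCubeBetaRep IsBallCubeRep DeligneIdentity cubeRep
   ballCubeRep isCubeBetaRep_cubeRep isBallCubeRep_ballCubeRep gammaHodgeSector_iff_canonical cubeRep_value
   value_of_isCubeBetaRep)
open Summit.KontsevichZagierPeriods.GammaHodgeSectorKO
open Summit.KontsevichZagierPeriods.KontsevichZagierPeriods.Theses.TerasomaMultiplication (GammaHodgeSector)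
open Summit.KontsevichZagierPeriods.KontsevichZagierPeriods.Theses.SelbergAMGM (PositiveCancellation)

/-! ## Lifting units and moving `Int.fract` along a congruence -/

/-- **Units lift along divisibility**: for `m ∣ n`, `0 < n`, every `u` coprime to `m` is congruent
mod `m` to a positive `u₁` coprime to `n` (`ZMod.unitsMap_surjective`). [folklore] -/
theorem exists_coprime_lift {m n : ℕ} (hn : 0 < n) (hmn : m ∣ n) {u : ℕ} (hu : Nat.Coprime u m) :
    ∃ u₁ : ℕ, 0 < u₁ ∧ u₁ ≡ u [MOD m] ∧ Nat.Coprime u₁ n := by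
  haveI : NeZero n := ⟨hn.ne'⟩
  obtain ⟨v, hv⟩ := ZMod.unitsMap_surjective hmn (ZMod.unitOfCoprime u hu)
  refine ⟨(v : ZMod n).val + n, by omega, ?_, ?_⟩
  · have h1 : (((v : ZMod n).val : ℕ) : ZMod m) = (u : ZMod m) := by
      have h2 := congrArg (fun w : (ZMod m)ˣ => (w : ZMod m)) hv
      simp only [ZMod.unitsMap_val, ZMod.coe_unitOfCoprime] at h2
      rw [← h2, ZMod.natCast_val]
    rw [← ZMod.natCast_eq_natCast_iff, Nat.cast_add, h1]
    obtain ⟨k, rfl⟩ := hmn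
    simp
  · exact Nat.coprime_add_self_left.mpr (ZMod.val_coe_unit_coprime v)

/-- `Int.fract (u₁ x) = Int.fract (u x)` when `u₁ ≡ u (mod m)` and `den x ∣ m`. [folklore] -/
theorem fract_mul_eq_of_modEq {m u u₁ : ℕ} (h : u₁ ≡ u [MOD m]) (x : ℚ) (hx : x.den ∣ m) :
    Int.fract ((u₁ : ℚ) * x) = Int.fract ((u : ℚ) * x) := by
  obtain ⟨t, ht⟩ : ∃ t : ℤ, (u₁ : ℤ) - u = m * t := Nat.modEq_iff_dvd.mp h.symm
  obtain ⟨k, hk⟩ := hx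
  have hden : (x.den : ℚ) * x = x.num := by rw [mul_comm]; exact Rat.mul_den_eq_num x
  have hu : (u₁ : ℚ) = (u : ℚ) + (m : ℚ) * t := by
    have h' : ((u₁ : ℤ) : ℚ) - ((u : ℤ) : ℚ) = ((m : ℤ) : ℚ) * (t : ℚ) := by exact_mod_cast ht
    push_cast at h'
    linarith
  have key : (u₁ : ℚ) * x = (u : ℚ) * x + ((t * k * x.num : ℤ) : ℚ) := by
    rw [hu, hk]
    push_cast
    linear_combination (k : ℚ) * (t : ℚ) * hden
  rw [key, Int.fract_add_intCast]

/-- A Beta class with an integral exponent in EITHER slot is a constant of `P`. [folklore] -/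
theorem betaClass_eq_kap_of_degenerate (a b : ℚ) (ha : 0 < a) (hb : 0 < b)
    (h : Int.fract a = 0 ∨ Int.fract b = 0) :
    ∃ hc : IsAlgebraic ℚ (ProbabilityTheory.beta (a : ℝ) b),
      betaClass a b = kap (ProbabilityTheory.beta (a : ℝ) b) hc := by
  rcases h with h | h
  · obtain ⟨hc, e⟩ := betaClass_eq_kap_of_fract_eq_zero b a hb ha h
    have hsymm : ProbabilityTheory.beta (b : ℝ) a = ProbabilityTheory.beta (a : ℝ) b := by
      simp only [ProbabilityTheory.beta]; rw [mul_comm, add_comm]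
    refine ⟨hsymm ▸ hc, ?_⟩
    rw [stub_betaRelators.1 a b ha hb, e]
    exact kap_congr _ _ hsymm
  · exact betaClass_eq_kap_of_fract_eq_zero a b ha hb h

/-- A degenerate factor contributes `0` to the Hodge sum at every `u`. [folklore] -/
theorem hodgeTerm_eq_zero_of_degenerate (x y : ℚ) (h : Int.fract x = 0 ∨ Int.fract y = 0) (u : ℕ) :
    Int.fract ((u : ℚ) * x) + Int.fract ((u : ℚ) * y) - Int.fract ((u : ℚ) * (x + y)) = 0 := by
  rcases h with h | h
  · obtain ⟨z, hz⟩ := Int.fract_eq_zero_iff.mp h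
    rw [← hz, show (u : ℚ) * (z : ℚ) = (((u : ℤ) * z : ℤ) : ℚ) by push_cast; ring, Int.fract_intCast,
      mul_add, show (u : ℚ) * (z : ℚ) = (((u : ℤ) * z : ℤ) : ℚ) by push_cast; ring,
      Int.fract_intCast_add]
    ring
  · obtain ⟨z, hz⟩ := Int.fract_eq_zero_iff.mp h
    rw [← hz, show (u : ℚ) * (z : ℚ) = (((u : ℤ) * z : ℤ) : ℚ) by push_cast; ring, Int.fract_intCast,
      mul_add, show (u : ℚ) * (z : ℚ) = (((u : ℤ) * z : ℤ) : ℚ) by push_cast; ring,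
      Int.fract_add_intCast]
    ring

/-! ## The reduction -/

/-- **`GammaHodgeSector → BetaProductHodgeSector`** (the second split child of crux 4, verbatim):
Conjecture 1 for Hodge-type (2,2) Beta-product pairs with arbitrary positive rational exponents follows
from the Γ-Hodge sector crux (stmt-3742) by stripping the integral-exponent factors (constants of `P`)
and lifting the Hodge test to units coprime to all denominators. [cite: Deligne1982HodgeCycles, Thm. 7.18] -/
theorem betaProductHodgeSector_of_gammaHodgeSector (hGH : GammaHodgeSector) :
    ∀ (a b e d a' b' e' d' : ℚ) (q : ℝ), 0 < a → 0 < b → 0 < e → 0 < d → 0 < a' → 0 < b' → 0 < e' → 0 < d' → IsAlgebraic ℚ q → (∀ u : ℕ, 0 < u → Nat.Coprime u a.den → Nat.Coprime u b.den → Nat.Coprime u e.den → Nat.Coprime u d.den → Nat.Coprime u a'.den → Nat.Coprime u b'.den → Nat.Coprime u e'.den → Nat.Coprime u d'.den → (Int.fract ((u:ℚ) * a) + Int.fract ((u:ℚ) * b) - Int.fract ((u:ℚ) * (a + b))) + (Int.fract ((u:ℚ) * e) + Int.fract ((u:ℚ) * d) - Int.fract ((u:ℚ) * (e + d))) = (Int.fract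 ((u:ℚ) * a') + Int.fract ((u:ℚ) * b') - Int.fract ((u:ℚ) * (a' + b'))) + (Int.fract ((u:ℚ) * e') + Int.fract ((u:ℚ) * d') - Int.fract ((u:ℚ) * (e' + d')))) → ∀ (r r' : Literature.NumberTheory.Transcendental.KZ.IntegralRep 2), r.domain = {x | ∀ i, x i ∈ Set.Ioo (0:ℝ) 1} → Set.EqOn r.integrand (fun x => (x 0) ^ ((a:ℝ) - 1) * (1 - x 0) ^ ((b:ℝ) - 1) * (x 1) ^ ((e:ℝ) - 1) * (1 - x 1) ^ ((d:ℝ) - 1)) r.domain → r'.domain = {x | ∀ i, x i ∈ Set.Ioo (0:ℝ) 1} → Set.EqOn r'.integrand (fun x => q * (x 0) ^ ((a':ℝ) - 1) * (1 - x 0) ^ ((b':ℝ) - 1) * (x 1) ^ ((e':ℝ) - 1) * (1 - x 1) ^ ((d':ℝ) - 1)) r'.domain → r.value = r'.value → Literature.NumberTheory.Transcendental.KZ.Equivalent r r' := by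
  classical
  intro a b e d a' b' e' d' q ha hb he hd ha' hb' he' hd' hq hH r r' hrd hri hr'd hr'i hv
  -- the data in indexed form
  set x : Fin 2 → ℚ := ![a, e] with hxdef
  set y : Fin 2 → ℚ := ![b, d] with hydef
  set x' : Fin 2 → ℚ := ![a', e'] with hx'def
  set y' : Fin 2 → ℚ := ![b', d'] with hy'def
  have hpos : ∀ j, 0 < x j ∧ 0 < y j := Fin.forall_fin_two.2 ⟨⟨ha, hb⟩, ⟨he, hd⟩⟩
  have hpos' : ∀ j, 0 < x' j ∧ 0 < y' j := Fin.forall_fin_two.2 ⟨⟨ha', hb'⟩, ⟨he', hd'⟩⟩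
  -- the Hodge hypothesis in indexed form
  have hHi : ∀ u : ℕ, 0 < u → CoprimeDen x y u → CoprimeDen x' y' u → hodgeSum x y u = hodgeSum x' y' u := by
    intro u hu hc hc'
    have h0 := hc 0
    have h1 := hc 1
    have h0' := hc' 0
    have h1' := hc' 1
    simp only [hxdef, hydef, hx'def, hy'def, Matrix.cons_val_zero, Matrix.cons_val_one] at h0 h1 h0' h1'
    have key := hH u hu h0.1 h0.2 h1.1 h1.2 h0'.1 h0'.2 h1'.1 h1'.2
    simp only [hodgeSum, Fin.sum_univ_two, hxdef, hydef, hx'def, hy'def, Matrix.cons_val_zero,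
      Matrix.cons_val_one]
    linarith
  -- classes of `r` and `r'` in `P`
  have hr : IsCubeBetaRep x y r := by
    refine ⟨hrd, fun t ht => ?_⟩
    rw [hri ht]
    simp only [hxdef, hydef, Fin.prod_univ_two, Matrix.cons_val_zero, Matrix.cons_val_one]
    ring
  have er : toFormalPeriod (of r) = ∏ j, betaClass (x j) (y j) := cubeProduct_holds x y r hpos hr
  have heq' : Equivalent r' ((cubeRep x' y' hpos').constMul q hq) := by
    refine of_sub_of_mem_relations_of_eqOn ?_ fun t ht => ?_
    · rw [IntegralRep.domain_constMul, hr'd]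
      rfl
    · rw [hr'i ht, IntegralRep.integrand_constMul]
      show _ = q * ∏ j : Fin 2, (t j) ^ (((x' j : ℚ) : ℝ) - 1) * (1 - t j) ^ (((y' j : ℚ) : ℝ) - 1)
      simp only [hx'def, hy'def, Fin.prod_univ_two, Matrix.cons_val_zero, Matrix.cons_val_one]
      ring
  have er' : toFormalPeriod (of r') = kap q hq * ∏ j, betaClass (x' j) (y' j) := by
    rw [heq'.toFormalPeriod_eq, KZ.toFormalPeriod_of_constMul]
    congr 1
    exact cubeProduct_holds x' y' _ hpos' (isCubeBetaRep_cubeRep x' y' hpos')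
  -- the value identity in indexed form
  have hid : ∏ j, ProbabilityTheory.beta ((x j : ℚ) : ℝ) (y j) =
      q * ∏ j, ProbabilityTheory.beta ((x' j : ℚ) : ℝ) (y' j) := by
    rw [← value_of_isCubeBetaRep hpos hr, hv, Equivalent.value_eq_holds heq', IntegralRep.value_constMul,
      cubeRep_value]
  -- kept (admissible) factors on each side
  set p : Fin 2 → Prop := fun j => Int.fract (x j) ≠ 0 ∧ Int.fract (y j) ≠ 0 with hpdef
  set p' : Fin 2 → Prop := fun j => Int.fract (x' j) ≠ 0 ∧ Int.fract (y' j) ≠ 0 with hp'def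
  set K := {j : Fin 2 // p j} with hKdef
  set K' := {j : Fin 2 // p' j} with hK'def
  set eK : K ≃ Fin (Fintype.card K) := Fintype.equivFin K with heKdef
  set eK' : K' ≃ Fin (Fintype.card K') := Fintype.equivFin K' with heK'def
  set xK : Fin (Fintype.card K) → ℚ := fun l => x ((eK.symm l : K) : Fin 2) with hxKdef
  set yK : Fin (Fintype.card K) → ℚ := fun l => y ((eK.symm l : K) : Fin 2) with hyKdef
  set xK' : Fin (Fintype.card K') → ℚ := fun l => x' ((eK'.symm l : K') : Fin 2) with hxK'def
  set yK' : Fin (Fintype.card K') → ℚ := fun l => y' ((eK'.symm l : K') : Fin 2) with hyK'def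
  have hxK : Admissible xK yK := fun l =>
    ⟨(hpos _).1, (hpos _).2, (eK.symm l).2.1, (eK.symm l).2.2⟩
  have hxK' : Admissible xK' yK' := fun l =>
    ⟨(hpos' _).1, (hpos' _).2, (eK'.symm l).2.1, (eK'.symm l).2.2⟩
  -- re-indexing of sums / products over the kept factors
  have hsumK : ∀ f : Fin 2 → ℚ, ∑ j ∈ Finset.univ.filter p, f j = ∑ l, f ((eK.symm l : K) : Fin 2) := by
    intro f
    rw [Finset.sum_subtype (Finset.univ.filter p) (p := p) (fun j => by simp)]
    exact Fintype.sum_equiv eK _ _ fun j => by simp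
  have hsumK' : ∀ f : Fin 2 → ℚ, ∑ j ∈ Finset.univ.filter p', f j = ∑ l, f ((eK'.symm l : K') : Fin 2) := by
    intro f
    rw [Finset.sum_subtype (Finset.univ.filter p') (p := p') (fun j => by simp)]
    exact Fintype.sum_equiv eK' _ _ fun j => by simp
  have hprodK : ∀ {M : Type} [CommMonoid M] (f : Fin 2 → M),
      ∏ j ∈ Finset.univ.filter p, f j = ∏ l, f ((eK.symm l : K) : Fin 2) := by
    intro M _ f
    rw [Finset.prod_subtype (Finset.univ.filter p) (p := p) (fun j => by simp)]
    exact Fintype.prod_equiv eK _ _ fun j => by simp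
  have hprodK' : ∀ {M : Type} [CommMonoid M] (f : Fin 2 → M),
      ∏ j ∈ Finset.univ.filter p', f j = ∏ l, f ((eK'.symm l : K') : Fin 2) := by
    intro M _ f
    rw [Finset.prod_subtype (Finset.univ.filter p') (p := p') (fun j => by simp)]
    exact Fintype.prod_equiv eK' _ _ fun j => by simp
  -- the dropped factors are constants of `P`
  have hnp : ∀ j, ¬ p j → Int.fract (x j) = 0 ∨ Int.fract (y j) = 0 := by
    intro j hj
    by_contra hcon
    simp only [not_or] at hcon
    exact hj ⟨hcon.1, hcon.2⟩
  have hnp' : ∀ j, ¬ p' j → Int.fract (x' j) = 0 ∨ Int.fract (y' j) = 0 := by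
    intro j hj
    by_contra hcon
    simp only [not_or] at hcon
    exact hj ⟨hcon.1, hcon.2⟩
  obtain ⟨hcL, ecL⟩ := prod_eq_kap_prod (Finset.univ.filter fun j => ¬ p j) (fun j => betaClass (x j) (y j))
    (fun j => ProbabilityTheory.beta ((x j : ℚ) : ℝ) (y j))
    (fun j hj => betaClass_eq_kap_of_degenerate (x j) (y j) (hpos j).1 (hpos j).2
      (hnp j (Finset.mem_filter.mp hj).2))
  obtain ⟨hcR, ecR⟩ := prod_eq_kap_prod (Finset.univ.filter fun j => ¬ p' j) (fun j => betaClass (x' j) (y' j))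
    (fun j => ProbabilityTheory.beta ((x' j : ℚ) : ℝ) (y' j))
    (fun j hj => betaClass_eq_kap_of_degenerate (x' j) (y' j) (hpos' j).1 (hpos' j).2
      (hnp' j (Finset.mem_filter.mp hj).2))
  set dropL : ℝ := ∏ j ∈ Finset.univ.filter (fun j => ¬ p j), ProbabilityTheory.beta ((x j : ℚ) : ℝ) (y j)
    with hdropLdef
  set dropR : ℝ := ∏ j ∈ Finset.univ.filter (fun j => ¬ p' j), ProbabilityTheory.beta ((x' j : ℚ) : ℝ) (y' j)
    with hdropRdef
  have hdropL : 0 < dropL := Finset.prod_pos fun j _ =>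
    ProbabilityTheory.beta_pos (by exact_mod_cast (hpos j).1) (by exact_mod_cast (hpos j).2)
  have hdropR : 0 < dropR := Finset.prod_pos fun j _ =>
    ProbabilityTheory.beta_pos (by exact_mod_cast (hpos' j).1) (by exact_mod_cast (hpos' j).2)
  -- the reduced constant
  set c₁ : ℝ := q * dropR * dropL⁻¹ with hc₁def
  have hc₁ : IsAlgebraic ℚ c₁ := (hq.mul hcR).mul hcL.inv
  -- the Hodge test of the kept data: lift the unit, drop the vanishing terms
  have hHK : HodgeCondition (Fintype.card K) (Fintype.card K') 0 xK yK xK' yK' := by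
    intro u hu hcu hcu'
    -- moduli
    set mK : ℕ := (∏ j ∈ Finset.univ.filter p, ((x j).den * (y j).den)) *
      (∏ j ∈ Finset.univ.filter p', ((x' j).den * (y' j).den)) with hmKdef
    set nA : ℕ := (∏ j, ((x j).den * (y j).den)) * (∏ j, ((x' j).den * (y' j).den)) with hnAdef
    have hnA : 0 < nA := by positivity
    have hmn : mK ∣ nA :=
      mul_dvd_mul (Finset.prod_dvd_prod_of_subset _ _ _ (Finset.filter_subset _ _))
        (Finset.prod_dvd_prod_of_subset _ _ _ (Finset.filter_subset _ _))
    have hum : Nat.Coprime u mK := by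
      refine Nat.Coprime.mul_right ?_ ?_
      · refine Nat.coprime_prod_right_iff.mpr fun j hj => ?_
        have hj' : p j := (Finset.mem_filter.mp hj).2
        have h := hcu (eK ⟨j, hj'⟩)
        simp only [hxKdef, hyKdef, Equiv.symm_apply_apply] at h
        exact Nat.Coprime.mul_right h.1 h.2
      · refine Nat.coprime_prod_right_iff.mpr fun j hj => ?_
        have hj' : p' j := (Finset.mem_filter.mp hj).2
        have h := hcu' (eK' ⟨j, hj'⟩)
        simp only [hxK'def, hyK'def, Equiv.symm_apply_apply] at h
        exact Nat.Coprime.mul_right h.1 h.2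
    obtain ⟨u₁, hu₁, hmod, hcop⟩ := exists_coprime_lift hnA hmn hum
    -- `u₁` is coprime to every one of the eight denominators
    have hdvdL : ∀ j, (x j).den ∣ nA ∧ (y j).den ∣ nA := fun j => by
      have hj : (x j).den * (y j).den ∣ nA :=
        (Finset.dvd_prod_of_mem (fun j => (x j).den * (y j).den) (Finset.mem_univ j)).trans (dvd_mul_right _ _)
      exact ⟨(dvd_mul_right _ _).trans hj, (dvd_mul_left _ _).trans hj⟩
    have hdvdR : ∀ j, (x' j).den ∣ nA ∧ (y' j).den ∣ nA := fun j => by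
      have hj : (x' j).den * (y' j).den ∣ nA :=
        (Finset.dvd_prod_of_mem (fun j => (x' j).den * (y' j).den) (Finset.mem_univ j)).trans (dvd_mul_left _ _)
      exact ⟨(dvd_mul_right _ _).trans hj, (dvd_mul_left _ _).trans hj⟩
    have hc1 : CoprimeDen x y u₁ := fun j =>
      ⟨hcop.coprime_dvd_right (hdvdL j).1, hcop.coprime_dvd_right (hdvdL j).2⟩
    have hc1' : CoprimeDen x' y' u₁ := fun j =>
      ⟨hcop.coprime_dvd_right (hdvdR j).1, hcop.coprime_dvd_right (hdvdR j).2⟩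
    have hfull := hHi u₁ hu₁ hc1 hc1'
    -- kept denominators divide `mK`
    have hdenK : ∀ j, p j → (x j).den ∣ mK ∧ (y j).den ∣ mK ∧ (x j + y j).den ∣ mK := by
      intro j hj
      have hmem : j ∈ Finset.univ.filter p := Finset.mem_filter.mpr ⟨Finset.mem_univ j, hj⟩
      have hxy : (x j).den * (y j).den ∣ mK :=
        (Finset.dvd_prod_of_mem (fun j => (x j).den * (y j).den) hmem).trans (dvd_mul_right _ _)
      exact ⟨(dvd_mul_right _ _).trans hxy, (dvd_mul_left _ _).trans hxy, (Rat.add_den_dvd _ _).trans hxy⟩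
    have hdenK' : ∀ j, p' j → (x' j).den ∣ mK ∧ (y' j).den ∣ mK ∧ (x' j + y' j).den ∣ mK := by
      intro j hj
      have hmem : j ∈ Finset.univ.filter p' := Finset.mem_filter.mpr ⟨Finset.mem_univ j, hj⟩
      have hxy : (x' j).den * (y' j).den ∣ mK :=
        (Finset.dvd_prod_of_mem (fun j => (x' j).den * (y' j).den) hmem).trans (dvd_mul_left _ _)
      exact ⟨(dvd_mul_right _ _).trans hxy, (dvd_mul_left _ _).trans hxy, (Rat.add_den_dvd _ _).trans hxy⟩
    -- the kept sums at `u` are the kept sums at `u₁`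
    have hKu : hodgeSum xK yK u = ∑ j ∈ Finset.univ.filter p,
        (Int.fract ((u₁ : ℚ) * x j) + Int.fract ((u₁ : ℚ) * y j) - Int.fract ((u₁ : ℚ) * (x j + y j))) := by
      unfold hodgeSum
      rw [hsumK]
      refine Finset.sum_congr rfl fun l _ => ?_
      obtain ⟨h1, h2, h3⟩ := hdenK _ (eK.symm l).2
      simp only [hxKdef, hyKdef]
      rw [fract_mul_eq_of_modEq hmod _ h1, fract_mul_eq_of_modEq hmod _ h2, fract_mul_eq_of_modEq hmod _ h3]
    have hKu' : hodgeSum xK' yK' u = ∑ j ∈ Finset.univ.filter p',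
        (Int.fract ((u₁ : ℚ) * x' j) + Int.fract ((u₁ : ℚ) * y' j) - Int.fract ((u₁ : ℚ) * (x' j + y' j))) := by
      unfold hodgeSum
      rw [hsumK']
      refine Finset.sum_congr rfl fun l _ => ?_
      obtain ⟨h1, h2, h3⟩ := hdenK' _ (eK'.symm l).2
      simp only [hxK'def, hyK'def]
      rw [fract_mul_eq_of_modEq hmod _ h1, fract_mul_eq_of_modEq hmod _ h2, fract_mul_eq_of_modEq hmod _ h3]
    -- the full sums at `u₁` are the kept sums at `u₁` (dropped terms vanish)
    have hLu : hodgeSum x y u₁ = ∑ j ∈ Finset.univ.filter p,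
        (Int.fract ((u₁ : ℚ) * x j) + Int.fract ((u₁ : ℚ) * y j) - Int.fract ((u₁ : ℚ) * (x j + y j))) := by
      unfold hodgeSum
      rw [← Finset.sum_filter_add_sum_filter_not Finset.univ p]
      have hzero : ∑ j ∈ Finset.univ.filter (fun j => ¬ p j),
          (Int.fract ((u₁ : ℚ) * x j) + Int.fract ((u₁ : ℚ) * y j) - Int.fract ((u₁ : ℚ) * (x j + y j))) = 0 :=
        Finset.sum_eq_zero fun j hj => hodgeTerm_eq_zero_of_degenerate _ _ (hnp j (Finset.mem_filter.mp hj).2) u₁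
      rw [hzero, add_zero]
    have hRu : hodgeSum x' y' u₁ = ∑ j ∈ Finset.univ.filter p',
        (Int.fract ((u₁ : ℚ) * x' j) + Int.fract ((u₁ : ℚ) * y' j) - Int.fract ((u₁ : ℚ) * (x' j + y' j))) := by
      unfold hodgeSum
      rw [← Finset.sum_filter_add_sum_filter_not Finset.univ p']
      have hzero : ∑ j ∈ Finset.univ.filter (fun j => ¬ p' j),
          (Int.fract ((u₁ : ℚ) * x' j) + Int.fract ((u₁ : ℚ) * y' j) - Int.fract ((u₁ : ℚ) * (x' j + y' j))) = 0 :=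
        Finset.sum_eq_zero fun j hj => hodgeTerm_eq_zero_of_degenerate _ _ (hnp' j (Finset.mem_filter.mp hj).2) u₁
      rw [hzero, add_zero]
    rw [hKu, hKu', ← hLu, ← hRu, hfull, Nat.cast_zero, sub_self]
  -- the Deligne identity of the kept data
  have hsplitL : ∏ j, ProbabilityTheory.beta ((x j : ℚ) : ℝ) (y j) =
      (∏ l, ProbabilityTheory.beta ((xK l : ℚ) : ℝ) (yK l)) * dropL := by
    rw [← Finset.prod_filter_mul_prod_filter_not Finset.univ p, hprodK]
  have hsplitR : ∏ j, ProbabilityTheory.beta ((x' j : ℚ) : ℝ) (y' j) =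
      (∏ l, ProbabilityTheory.beta ((xK' l : ℚ) : ℝ) (yK' l)) * dropR := by
    rw [← Finset.prod_filter_mul_prod_filter_not Finset.univ p', hprodK']
  have hD : DeligneIdentity 0 xK yK xK' yK' c₁ := by
    unfold DeligneIdentity
    rw [pow_zero, mul_one]
    have h := hid
    rw [hsplitL, hsplitR] at h
    have hne : dropL ≠ 0 := hdropL.ne'
    calc ∏ l, ProbabilityTheory.beta ((xK l : ℚ) : ℝ) (yK l)
        = ((∏ l, ProbabilityTheory.beta ((xK l : ℚ) : ℝ) (yK l)) * dropL) * dropL⁻¹ := by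
          rw [mul_inv_cancel_right₀ hne]
      _ = (q * ((∏ l, ProbabilityTheory.beta ((xK' l : ℚ) : ℝ) (yK' l)) * dropR)) * dropL⁻¹ := by rw [h]
      _ = c₁ * ∏ l, ProbabilityTheory.beta ((xK' l : ℚ) : ℝ) (yK' l) := by rw [hc₁def]; ring
  -- the crux, in canonical form, for the kept data
  have E := (gammaHodgeSector_iff_canonical.mp hGH) _ _ 0 xK yK xK' yK' c₁ hxK hxK' hHK hc₁ hD
  have e1 : toFormalPeriod (of (cubeRep xK yK hxK.pos)) = ∏ l, betaClass (xK l) (yK l) :=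
    cubeProduct_holds xK yK _ hxK.pos (isCubeBetaRep_cubeRep xK yK hxK.pos)
  have e2 : toFormalPeriod (of (ballCubeRep 0 xK' yK' c₁ hc₁ hxK'.pos)) =
      kap c₁ hc₁ * betaClass (1 / 2) (1 / 2) ^ 0 * ∏ l, betaClass (xK' l) (yK' l) :=
    stub_products.2.1 0 xK' yK' c₁ hc₁ _ hxK'.pos (isBallCubeRep_ballCubeRep 0 xK' yK' c₁ hc₁ hxK'.pos)
  have eKept : ∏ l, betaClass (xK l) (yK l) = kap c₁ hc₁ * ∏ l, betaClass (xK' l) (yK' l) := by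
    rw [← e1, E.toFormalPeriod_eq, e2, pow_zero, mul_one]
  -- constants recombine: κ(c₁) κ(dropL) = κ(q) κ(dropR)
  have hconst : kap c₁ hc₁ * kap dropL hcL = kap q hq * kap dropR hcR := by
    rw [← kap_mul, ← kap_mul]
    exact kap_congr _ _ (by rw [hc₁def, inv_mul_cancel_right₀ hdropL.ne'])
  -- assemble
  change of r - of r' ∈ relations
  rw [← toFormalPeriod_eq_iff, er, er',
    ← Finset.prod_filter_mul_prod_filter_not Finset.univ p (fun j => betaClass (x j) (y j)),
    ← Finset.prod_filter_mul_prod_filter_not Finset.univ p' (fun j => betaClass (x' j) (y' j)),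
    hprodK, hprodK', ecL, ecR, eKept]
  calc kap c₁ hc₁ * (∏ l, betaClass (xK' l) (yK' l)) * kap dropL hcL
      = (kap c₁ hc₁ * kap dropL hcL) * ∏ l, betaClass (xK' l) (yK' l) := by ring
    _ = (kap q hq * kap dropR hcR) * ∏ l, betaClass (xK' l) (yK' l) := by rw [hconst]
    _ = kap q hq * ((∏ l, betaClass (xK' l) (yK' l)) * kap dropR hcR) := by ring

/-- **`PositiveCancellation` (stmt-5621) alone → `BetaProductHodgeSector`**, through the landed
`gammaHodgeSector_of_positiveCancellation_alone`. [cite: Deligne1982HodgeCycles, Thm. 7.18] -/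
theorem betaProductHodgeSector_of_positiveCancellation (hPC : PositiveCancellation) :
    ∀ (a b e d a' b' e' d' : ℚ) (q : ℝ), 0 < a → 0 < b → 0 < e → 0 < d → 0 < a' → 0 < b' → 0 < e' → 0 < d' → IsAlgebraic ℚ q → (∀ u : ℕ, 0 < u → Nat.Coprime u a.den → Nat.Coprime u b.den → Nat.Coprime u e.den → Nat.Coprime u d.den → Nat.Coprime u a'.den → Nat.Coprime u b'.den → Nat.Coprime u e'.den → Nat.Coprime u d'.den → (Int.fract ((u:ℚ) * a) + Int.fract ((u:ℚ) * b) - Int.fract ((u:ℚ) * (a + b))) + (Int.fract ((u:ℚ) * e) + Int.fract ((u:ℚ) * d) - Int.fract ((u:ℚ) * (e + d))) = (Int.fract ((u:ℚ) * a') + Int.fract ((u:ℚ) * b') - Int.fract ((u:ℚ) * (a' + b'))) + (Int.fract ((u:ℚ) * e') + Int.fract ((u:ℚ) * d') - Int.fract ((u:ℚ) * (e' + d')))) → ∀ (r r' : Literature.NumberTheory.Transcendental.KZ.IntegralRep 2), r.domain = {x | ∀ i, x i ∈ Set.Ioo (0:ℝ) 1} → Set.EqOn r.integrand (fun x => (x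 0) ^ ((a:ℝ) - 1) * (1 - x 0) ^ ((b:ℝ) - 1) * (x 1) ^ ((e:ℝ) - 1) * (1 - x 1) ^ ((d:ℝ) - 1)) r.domain → r'.domain = {x | ∀ i, x i ∈ Set.Ioo (0:ℝ) 1} → Set.EqOn r'.integrand (fun x => q * (x 0) ^ ((a':ℝ) - 1) * (1 - x 0) ^ ((b':ℝ) - 1) * (x 1) ^ ((e':ℝ) - 1) * (1 - x 1) ^ ((d':ℝ) - 1)) r'.domain → r.value = r'.value → Literature.NumberTheory.Transcendental.KZ.Equivalent r r' :=
  betaProductHodgeSector_of_gammaHodgeSector (gammaHodgeSector_of_positiveCancellation_alone hPC)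


/-- **Value equality is the Beta identity** for the crux's pinned pair:
`B(a,b)·B(e,d) = q·(B(a',b')·B(e',d'))` (`B = ProbabilityTheory.beta = Γ(a)Γ(b)/Γ(a+b)`).
[cite: KontsevichZagier2001, §1.1] -/
theorem betaProduct_identity_of_valueEq {a b e d a' b' e' d' : ℚ}
    (ha : 0 < a) (hb : 0 < b) (he : 0 < e) (hd : 0 < d)
    (ha' : 0 < a') (hb' : 0 < b') (he' : 0 < e') (hd' : 0 < d') (q : ℝ) (hq : IsAlgebraic ℚ q)
    (r r' : IntegralRep 2)
    (hrd : r.domain = {x | ∀ i, x i ∈ Set.Ioo (0:ℝ) 1})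
    (hri : Set.EqOn r.integrand (fun x => (x 0) ^ ((a:ℝ) - 1) * (1 - x 0) ^ ((b:ℝ) - 1) *
      (x 1) ^ ((e:ℝ) - 1) * (1 - x 1) ^ ((d:ℝ) - 1)) r.domain)
    (hr'd : r'.domain = {x | ∀ i, x i ∈ Set.Ioo (0:ℝ) 1})
    (hr'i : Set.EqOn r'.integrand (fun x => q * (x 0) ^ ((a':ℝ) - 1) * (1 - x 0) ^ ((b':ℝ) - 1) *
      (x 1) ^ ((e':ℝ) - 1) * (1 - x 1) ^ ((d':ℝ) - 1)) r'.domain)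
    (hv : r.value = r'.value) :
    ProbabilityTheory.beta (a:ℝ) b * ProbabilityTheory.beta (e:ℝ) d =
      q * (ProbabilityTheory.beta (a':ℝ) b' * ProbabilityTheory.beta (e':ℝ) d') := by
  have hpos : ∀ j : Fin 2, 0 < ![a, e] j ∧ 0 < ![b, d] j :=
    Fin.forall_fin_two.2 ⟨⟨ha, hb⟩, ⟨he, hd⟩⟩
  have hpos' : ∀ j : Fin 2, 0 < ![a', e'] j ∧ 0 < ![b', d'] j :=
    Fin.forall_fin_two.2 ⟨⟨ha', hb'⟩, ⟨he', hd'⟩⟩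
  have hr : IsCubeBetaRep ![a, e] ![b, d] r := by
    refine ⟨hrd, fun t ht => ?_⟩
    rw [hri ht]
    simp only [Fin.prod_univ_two, Matrix.cons_val_zero, Matrix.cons_val_one]
    ring
  have h1 : r.value = ProbabilityTheory.beta (a:ℝ) b * ProbabilityTheory.beta (e:ℝ) d := by
    rw [value_of_isCubeBetaRep hpos hr]
    simp only [Fin.prod_univ_two, Matrix.cons_val_zero, Matrix.cons_val_one]
  have heq : Equivalent r' ((cubeRep ![a', e'] ![b', d'] hpos').constMul q hq) := by
    refine of_sub_of_mem_relations_of_eqOn ?_ fun t ht => ?_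
    · rw [IntegralRep.domain_constMul, hr'd]
      rfl
    · rw [hr'i ht, IntegralRep.integrand_constMul]
      show _ = q * ∏ j : Fin 2, (t j) ^ ((((![a', e'] : Fin 2 → ℚ) j : ℚ) : ℝ) - 1) *
        (1 - t j) ^ ((((![b', d'] : Fin 2 → ℚ) j : ℚ) : ℝ) - 1)
      simp only [Fin.prod_univ_two, Matrix.cons_val_zero, Matrix.cons_val_one]
      ring
  have h2 : r'.value = q * (ProbabilityTheory.beta (a':ℝ) b' * ProbabilityTheory.beta (e':ℝ) d') := by
    rw [Equivalent.value_eq_holds heq, IntegralRep.value_constMul, cubeRep_value]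
    simp only [Fin.prod_univ_two, Matrix.cons_val_zero, Matrix.cons_val_one]
  rw [← h1, ← h2]
  exact hv

/-- The composition, arrow form: HODGE TYPE → HODGE SECTOR → the crux (UNFOLDED verbatim, so that exactly one
theorem of this file, `BetaProductSector_of`, concludes the crux by name). [cite: KontsevichZagier2001, §1.2 Conjecture 1] -/
theorem betaProductSector_of_stubs
    (hT : ∀ (a b e d a' b' e' d' : ℚ) (q : ℝ), 0 < a → 0 < b → 0 < e → 0 < d → 0 < a' → 0 < b' → 0 < e' → 0 < d' → IsAlgebraic ℚ q → ProbabilityTheory.beta (a:ℝ) b * ProbabilityTheory.beta (e:ℝ) d = q * (ProbabilityTheory.beta (a':ℝ) b' * ProbabilityTheory.beta (e':ℝ) d') → ∀ u : ℕ, 0 < u → Nat.Coprime u a.den → Nat.Coprime u b.den → Nat.Coprime u e.den → Nat.Coprime u d.den → Nat.Coprime u a'.den → Nat.Coprime u b'.den → Nat.Coprime u e'.den → Nat.Coprime u d'.den → (Int.fract ((u:ℚ) * a) + Int.fract ((u:ℚ) * b) - Int.fract ((u:ℚ) * (a + b))) + (Int.fract ((u:ℚ) * e) + Int.fract ((u:ℚ)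 * d) - Int.fract ((u:ℚ) * (e + d))) = (Int.fract ((u:ℚ) * a') + Int.fract ((u:ℚ) * b') - Int.fract ((u:ℚ) * (a' + b'))) + (Int.fract ((u:ℚ) * e') + Int.fract ((u:ℚ) * d') - Int.fract ((u:ℚ) * (e' + d'))))
    (hG : ∀ (a b e d a' b' e' d' : ℚ) (q : ℝ), 0 < a → 0 < b → 0 < e → 0 < d → 0 < a' → 0 < b' → 0 < e' → 0 < d' → IsAlgebraic ℚ q → (∀ u : ℕ, 0 < u → Nat.Coprime u a.den → Nat.Coprime u b.den → Nat.Coprime u e.den → Nat.Coprime u d.den → Nat.Coprime u a'.den → Nat.Coprime u b'.den → Nat.Coprime u e'.den → Nat.Coprime u d'.den → (Int.fract ((u:ℚ) * a) + Int.fract ((u:ℚ) * b) - Int.fract ((u:ℚ) * (a + b))) + (Int.fract ((u:ℚ) * e) + Int.fract ((u:ℚ) * d) - Int.fract ((u:ℚ) * (e + d))) = (Int.fract ((u:ℚ) * a') + Int.fract ((u:ℚ) * b') - Int.fract ((u:ℚ) * (a' + b'))) + (Int.fract ((u:ℚ) * e') + Int.fract ((u:ℚ) * d') - Int.fract ((u:ℚ)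 * (e' + d')))) → ∀ (r r' : Literature.NumberTheory.Transcendental.KZ.IntegralRep 2), r.domain = {x | ∀ i, x i ∈ Set.Ioo (0:ℝ) 1} → Set.EqOn r.integrand (fun x => (x 0) ^ ((a:ℝ) - 1) * (1 - x 0) ^ ((b:ℝ) - 1) * (x 1) ^ ((e:ℝ) - 1) * (1 - x 1) ^ ((d:ℝ) - 1)) r.domain → r'.domain = {x | ∀ i, x i ∈ Set.Ioo (0:ℝ) 1} → Set.EqOn r'.integrand (fun x => q * (x 0) ^ ((a':ℝ) - 1) * (1 - x 0) ^ ((b':ℝ) - 1) * (x 1) ^ ((e':ℝ) - 1) * (1 - x 1) ^ ((d':ℝ) - 1)) r'.domain → r.value = r'.value → Literature.NumberTheory.Transcendental.KZ.Equivalent r r') :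
    ∀ (a b e d a' b' e' d' : ℚ) (q : ℝ), 0 < a → 0 < b → 0 < e → 0 < d → 0 < a' → 0 < b' → 0 < e' → 0 < d' → IsAlgebraic ℚ q → ∀ (r r' : Literature.NumberTheory.Transcendental.KZ.IntegralRep 2), r.domain = {x | ∀ i, x i ∈ Set.Ioo (0:ℝ) 1} → Set.EqOn r.integrand (fun x => (x 0) ^ ((a:ℝ) - 1) * (1 - x 0) ^ ((b:ℝ) - 1) * (x 1) ^ ((e:ℝ) - 1) * (1 - x 1) ^ ((d:ℝ) - 1)) r.domain → r'.domain = {x | ∀ i, x i ∈ Set.Ioo (0:ℝ) 1} → Set.EqOn r'.integrand (fun x => q * (x 0) ^ ((a':ℝ) - 1) * (1 - x 0) ^ ((b':ℝ) - 1) * (x 1) ^ ((e':ℝ) - 1) * (1 - x 1) ^ ((d':ℝ) - 1)) r'.domain → r.value = r'.value → Literature.NumberTheory.Transcendental.KZ.Equivalent r r' := by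
  intro a b e d a' b' e' d' q ha hb he hd ha' hb' he' hd' hq r r' hrd hri hr'd hr'i hv
  exact hG a b e d a' b' e' d' q ha hb he hd ha' hb' he' hd' hq
    (hT a b e d a' b' e' d' q ha hb he hd ha' hb' he' hd' hq
      (betaProduct_identity_of_valueEq ha hb he hd ha' hb' he' hd' q hq r r' hrd hri hr'd hr'i hv))
    r r' hrd hri hr'd hr'i hv

/-- **The skeleton theorem** (concludes the crux BY NAME; sorries enter only through the two named stubs).
[cite: KontsevichZagier2001, §1.2 Conjecture 1] -/
theorem BetaProductSector_of : BetaProductSector :=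
  betaProductSector_of_stubs stub_hodgeType stub_hodgeSector

/-! ## De-risking stub 2: it follows from `GammaHodgeSector` / `PositiveCancellation` -/

/-- **Stub 2 ⟸ `GammaHodgeSector`** (stmt-3742). [cite: Deligne1982HodgeCycles, Thm. 7.18] -/
theorem stub_hodgeSector_of_gammaHodgeSector (hGH : GammaHodgeSector) :
    ∀ (a b e d a' b' e' d' : ℚ) (q : ℝ), 0 < a → 0 < b → 0 < e → 0 < d → 0 < a' → 0 < b' → 0 < e' → 0 < d' → IsAlgebraic ℚ q → (∀ u : ℕ, 0 < u → Nat.Coprime u a.den → Nat.Coprime u b.den → Nat.Coprime u e.den → Nat.Coprime u d.den → Nat.Coprime u a'.den → Nat.Coprime u b'.den → Nat.Coprime u e'.den → Nat.Coprime u d'.den → (Int.fract ((u:ℚ) * a) + Int.fract ((u:ℚ) * b) - Int.fract ((u:ℚ) * (a + b))) + (Int.fract ((u:ℚ) * e) + Int.fract ((u:ℚ) * d) - Int.fract ((u:ℚ) * (e + d))) = (Int.fract ((u:ℚ) * a') + Int.fract ((u:ℚ) * b') - Int.fract ((u:ℚ) * (a' + b'))) + (Int.fract ((u:ℚ) * e')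 + Int.fract ((u:ℚ) * d') - Int.fract ((u:ℚ) * (e' + d')))) → ∀ (r r' : Literature.NumberTheory.Transcendental.KZ.IntegralRep 2), r.domain = {x | ∀ i, x i ∈ Set.Ioo (0:ℝ) 1} → Set.EqOn r.integrand (fun x => (x 0) ^ ((a:ℝ) - 1) * (1 - x 0) ^ ((b:ℝ) - 1) * (x 1) ^ ((e:ℝ) - 1) * (1 - x 1) ^ ((d:ℝ) - 1)) r.domain → r'.domain = {x | ∀ i, x i ∈ Set.Ioo (0:ℝ) 1} → Set.EqOn r'.integrand (fun x => q * (x 0) ^ ((a':ℝ) - 1) * (1 - x 0) ^ ((b':ℝ) - 1) * (x 1) ^ ((e':ℝ) - 1) * (1 - x 1) ^ ((d':ℝ) - 1)) r'.domain → r.value = r'.value → Literature.NumberTheory.Transcendental.KZ.Equivalent r r' :=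
  betaProductHodgeSector_of_gammaHodgeSector hGH

/-- **Stub 2 ⟸ `PositiveCancellation`** (stmt-5621) alone. [cite: Deligne1982HodgeCycles, Thm. 7.18] -/
theorem stub_hodgeSector_of_positiveCancellation (hPC : PositiveCancellation) :
    ∀ (a b e d a' b' e' d' : ℚ) (q : ℝ), 0 < a → 0 < b → 0 < e → 0 < d → 0 < a' → 0 < b' → 0 < e' → 0 < d' → IsAlgebraic ℚ q → (∀ u : ℕ, 0 < u → Nat.Coprime u a.den → Nat.Coprime u b.den → Nat.Coprime u e.den → Nat.Coprime u d.den → Nat.Coprime u a'.den → Nat.Coprime u b'.den → Nat.Coprime u e'.den → Nat.Coprime u d'.den → (Int.fract ((u:ℚ) * a) + Int.fract ((u:ℚ) * b) - Int.fract ((u:ℚ) * (a + b))) + (Int.fract ((u:ℚ) * e) + Int.fract ((u:ℚ) * d) - Int.fract ((u:ℚ) * (e + d))) = (Int.fract ((u:ℚ) * a') + Int.fract ((u:ℚ) * b') - Int.fract ((u:ℚ) * (a' + b'))) + (Int.fract ((u:ℚ) * e') + Int.fract ((u:ℚ) * d') - Int.fract ((u:ℚ) * (e' + d')))) → ∀ (r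 r' : Literature.NumberTheory.Transcendental.KZ.IntegralRep 2), r.domain = {x | ∀ i, x i ∈ Set.Ioo (0:ℝ) 1} → Set.EqOn r.integrand (fun x => (x 0) ^ ((a:ℝ) - 1) * (1 - x 0) ^ ((b:ℝ) - 1) * (x 1) ^ ((e:ℝ) - 1) * (1 - x 1) ^ ((d:ℝ) - 1)) r.domain → r'.domain = {x | ∀ i, x i ∈ Set.Ioo (0:ℝ) 1} → Set.EqOn r'.integrand (fun x => q * (x 0) ^ ((a':ℝ) - 1) * (1 - x 0) ^ ((b':ℝ) - 1) * (x 1) ^ ((e':ℝ) - 1) * (1 - x 1) ^ ((d':ℝ) - 1)) r'.domain → r.value = r'.value → Literature.NumberTheory.Transcendental.KZ.Equivalent r r' :=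
  betaProductHodgeSector_of_positiveCancellation hPC

end Summit.KontsevichZagierPeriods.KontsevichZagierPeriods.Cruxes.BetaProductSector.HodgeSplit

end
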